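import Literature.Geometry.Kaehler.ComplexTorusLefschetzConjugateOperator
import Literature.Geometry.Kaehler.ComplexTorusAndreHodgeInvolution
import Literature.Geometry.Kaehler.ComplexTorusLefschetzSL2ActionLattices
import Literature.Algebra.Lie.LefschetzModuleWeylOperator
import HarnessLib

/-!
# The Lefschetz–Kleiman algebra `ℂ[L_η, ᶜΛ_η]` stabilises Looijenga–Lunts' Hodge algebra `Hdg(X)` of a complex torus; its members
# `w`, `*_L`, `∗`, `*_H`, `ᶜL` preserve the `ℚ`-space of Hodge classes

Layer `Literature/Geometry/Kaehler`, namespace `Literature.Geometry.Kaehler.ComplexTorus`; lane `lit-hodgefound` (Track 2 foundations library),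
prover seat `lit-hodgefound-p35` (generation 50, row g50-#9; sequel of rows g50-#6 … g50-#8). THEOREMS ONLY (no definition, no named fact, no instance,
no notation; D-0026 net debt `0`). Consumed BY NAME, nothing restated: skel-1's A1-60 `ComplexTorusNeronSeveriLieAlgebraDefinedOverQ` (`hodgeAlgebraG Φ = Hdg(X)`,
the complex span of the rational `(p,p)`-classes in all degrees; its stabiliser `hodgeAlgebraEnd Φ`, a `ℂ`-subalgebra; `hodgeClassesG Φ`, the `ℚ`-space of all Hodge
classes; `lefschetzG_mem_hodgeAlgebraEnd`, `lefschetzDualG_mem_hodgeAlgebraEnd`, `mem_hodgeClassesG_iff_mem_rationalFormsG_and_mem_hodgeAlgebraG`), p09's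
`ComplexTorusLefschetzSL2ActionLattices` (`sl2Rep_mem_hodgeAlgebraEnd`: the same mechanism for `ρ(SL₂(ℂ))`), p34's abstract memberships in `K[e, ᶜΛ]`
(`weylOperator_mem_adjoin_pair_dual`, `lefschetzInvolution_mem_adjoin_pair_dual`, `hodgeInvolution_mem_adjoin_pair_dual`, `andreHodgeInvolution_mem_adjoin_pair_dual`,
`conj_lefschetzInvolution_mem_adjoin_pair_dual`), and the rationality rows: p35 g47-#3 (`weylOperator_apply_mem_rationalFormsG`), g49-#3
(`andreHodgeInvolution_apply_mem_rationalFormsG`), g50-#6 (`IsNSForm.lefschetzInvolution_/hodgeInvolution_apply_mem_rationalFormsG`), g50-#8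
(`IsNSForm.conj_lefschetzInvolution_mem_rationalEnd`).

METHOD (Looijenga–Lunts §3: "the Hodge algebra `Hdg(X)` […] is `𝔤_NS(X)`-invariant"; Milne, proof of Thm. 5.9: "all elements of the `ℚ`-algebra `ℚ[L, Λ]` are
Lefschetz. Since this algebra contains `ᶜΛ` and `∗`"). `hodgeAlgebraEnd Φ` is a `ℂ`-subalgebra containing `L_η` and `Λ_η = ᶜΛ` for `η ∈ NS_ℚ(X)` non-degenerate, hence
the whole subalgebra `ℂ[L_η, ᶜΛ_η]` they generate (§1); every named operator of the Lefschetz `𝔰𝔩₂` lies in that subalgebra (§2); an operator that is moreover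
RATIONAL maps `hodgeClassesG = rationalFormsG ∩ hodgeAlgebraG` into itself (§3).

## Sources, VERBATIM

* E. Looijenga, V. A. Lunts, *A Lie algebra attached to a projective variety*, Invent. Math. 129 (1997) [LooijengaLunts1997], held `paper:arxiv-alg-geom_9604014`,
  §3 p. 16: "the Hodge algebra `Hdg(X) ⊂ H(X)` (i.e., the complex span of the rational part of `⊕_k H^{k,k}(X)`) is `𝔤_NS(X)`-invariant"; §1 (1.7).
* J. S. Milne, *Lefschetz classes on abelian varieties*, Duke Math. J. 96 (1999) [Milne1999LefschetzClasses], `paper:doi-10-1215-s0012-7094-99-09620-5` p0027 L5–L9: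
  "all elements of the `ℚ`-algebra `ℚ[L, Λ]` are Lefschetz. Since this algebra contains `ᶜΛ` and `∗` (Kleiman 1968, 1.4.4), this proves the theorem"; Thm. 5.9.
* Y. André, *Pour une théorie inconditionnelle des motifs* (1996) [Andre1996Motifs], `paper-doi-10-1007-bf02698643` p0008 Prop. 1.2: "Les sous-algèbres `ℚ[L, *_L]`,
  `ℚ[L, *_H]`, `ℚ[L, *_L L *_L]`, `ℚ[L, ᶜΛ]` de `End H*(X)` sont égales"; §1.2: "l'élément `(0 1 ; -1 0)` de `SL₂` s'envoie sur `± *_H`".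
* C. Voisin, *Hodge Theory I* (2002) [VoisinHodgeI2002], §6.2.3 Rem. 6.27; Ch. 7 introduction (p. 131) / §7.1.2 (PDF p. 134): the Lefschetz decomposition is one
  "of rational sub-Hodge structures" when `L` preserves the rational cohomology.
* H. Lange, *Abelian Varieties over the Complex Numbers* (2023) [Lange2023AbelianVarietiesComplex], §7.2.2 (Hodge classes), §7.3.3 Exercise (1).

## What is proved (`η ∈ NS_ℚ(X)` non-degenerate: `hQ`, `hη`; `IsNSForm` where the rationality row needs it)

* §1 **`adjoin_lefschetzG_dual_le_hodgeAlgebraEnd`: `ℂ[L_η, ᶜΛ_η] ≤ Stab(Hdg(X))`** — THE WHOLE LEFSCHETZ–KLEIMAN ALGEBRA STABILISES THE HODGE ALGEBRA;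
  `adjoin_lefschetzG_lefschetzDualG_le_hodgeAlgebraEnd` (the same with p09's closed-form `Λ_η`), `mem_hodgeAlgebraEnd_of_mem_adjoin_lefschetzG_dual`.
* §2 **`weylOperator_mem_hodgeAlgebraEnd`**, **`lefschetzInvolution_mem_hodgeAlgebraEnd`**, **`hodgeInvolution_mem_hodgeAlgebraEnd`**, `andreHodgeInvolution_mem_hodgeAlgebraEnd`,
  `conj_lefschetzInvolution_mem_hodgeAlgebraEnd` (`w`, `*_L`, Kleiman–Milne's `∗`, André's `*_H`, `ᶜL` stabilise `Hdg(X)`), with the pointwise forms `…_apply_mem_hodgeAlgebraG`.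
* §3 THE `ℚ`-SPACE OF HODGE CLASSES: **`weylOperator_apply_mem_hodgeClassesG`**, **`IsNSForm.lefschetzInvolution_apply_mem_hodgeClassesG`**,
  **`IsNSForm.hodgeInvolution_apply_mem_hodgeClassesG`**, `andreHodgeInvolution_apply_mem_hodgeClassesG`, `IsNSForm.conj_lefschetzInvolution_apply_mem_hodgeClassesG`
  (`T(⊕ₘ⊕ₚ Hᵐ(X, ℚ) ∩ H^{p,p}) ⊆ ⊕ₘ⊕ₚ Hᵐ(X, ℚ) ∩ H^{p,p}`: rational AND Hodge-algebra preserving) — Milne's "Lefschetz operators carry Lefschetz/Hodge classes to such"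
  for the five involution-type operators, globally on `H•(X; ℚ)`; the degreewise bijections `Hdgᵖ ⥲ Hdg^{g-p}` are rows g47-#6 / g50-#6.
* §4 glue: `IsNSForm.lefschetzInvolution_mem_rationalEnd_and_mem_hodgeAlgebraEnd`, `IsNSForm.hodgeInvolution_mem_rationalEnd_and_mem_hodgeAlgebraEnd`.

## Scope / not here

The `ℚ`-STRUCTURE of the algebra itself (`*_L ∈ ℚ[L, Λ]` with rational coefficients, André's equalities of `ℚ`-algebras) is not formalised at the `GForm` level (the tree's
adjoin is over `ℂ`); Milne's algebraicity (Thm. 5.9) is not formalised. Only invariant forms of complex tori.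
-/

noncomputable section

-- `Module ℂ` / `SMulZeroClass ℂ` synthesis on `E [⋀^Fin k]→L[ℝ] ℂ` (as in `ComplexTorusLefschetzDecomposition`)
set_option maxSynthPendingDepth 3

open Module Function Finset
open Literature.LinearAlgebra.Alternating Literature.Algebra.Lie Literature.Analysis.Complex

namespace Literature.Geometry.Kaehler

namespace ComplexTorus

universe uE

variable {ι : Type*} [Fintype ι] [DecidableEq ι] {E : Type uE} [NormedAddCommGroup E] [NormedSpace ℂ E] [FiniteDimensional ℂ E] [Nontrivial E]
  (Φ : (ι → ℝ) ≃L[ℝ] E) {η : E [⋀^Fin 2]→L[ℝ] ℝ}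

/-! ## §1 `ℂ[L_η, ᶜΛ_η] ≤ Stab(Hdg(X))` -/

section Adjoin

/-- **THE LEFSCHETZ–KLEIMAN ALGEBRA STABILISES THE HODGE ALGEBRA: `ℂ[L_η, ᶜΛ_η] ≤ Stab(Hdg(X))`** for every non-degenerate `η ∈ NS_ℚ(X)` — `Stab(Hdg(X)) = hodgeAlgebraEnd Φ`
is a `ℂ`-subalgebra containing `L_η` (bidegree `(1,1)`, rational) and its `𝔰𝔩₂`-partner `ᶜΛ_η = Λ_η` (bidegree `(-1,-1)`, rational). [cite: LooijengaLunts1997, §3 p. 16]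
[cite: Milne1999LefschetzClasses, §5 p. 665 (proof of Thm. 5.9)] [cite: VoisinHodgeI2002, §6.2.3 Rem. 6.27] -/
theorem adjoin_lefschetzG_dual_le_hodgeAlgebraEnd (hQ : η ∈ neronSeveriQ Φ) (hη : ∀ v : E, v ≠ 0 → ∃ w : E, η ![v, w] ≠ 0) :
    Algebra.adjoin ℂ ({lefschetzG η, (hasLefschetzProperty_lefschetzG hη).dual isZGrading_countingG} : Set (Module.End ℂ (GForm E ℂ))) ≤
      hodgeAlgebraEnd Φ := by
  refine Algebra.adjoin_le ?_
  rintro T (rfl | rfl)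
  · exact lefschetzG_mem_hodgeAlgebraEnd Φ hQ
  · rw [dual_lefschetzG_eq_lefschetzDualG hη]
    exact lefschetzDualG_mem_hodgeAlgebraEnd Φ hQ hη

/-- The same with p09's closed form `Λ_η = lefschetzDualG η`: **`ℂ[L_η, Λ_η] ≤ Stab(Hdg(X))`.** [cite: LooijengaLunts1997, §3 p. 16] [cite: Milne1999LefschetzClasses, §5 p. 665] -/
theorem adjoin_lefschetzG_lefschetzDualG_le_hodgeAlgebraEnd (hQ : η ∈ neronSeveriQ Φ) (hη : ∀ v : E, v ≠ 0 → ∃ w : E, η ![v, w] ≠ 0) :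
    Algebra.adjoin ℂ ({lefschetzG η, lefschetzDualG η} : Set (Module.End ℂ (GForm E ℂ))) ≤ hodgeAlgebraEnd Φ := by
  rw [← dual_lefschetzG_eq_lefschetzDualG hη]
  exact adjoin_lefschetzG_dual_le_hodgeAlgebraEnd Φ hQ hη

/-- Membership form: every `T ∈ ℂ[L_η, ᶜΛ_η]` stabilises `Hdg(X)`. [cite: LooijengaLunts1997, §3 p. 16] [cite: Milne1999LefschetzClasses, §5 p. 665] -/
theorem mem_hodgeAlgebraEnd_of_mem_adjoin_lefschetzG_dual (hQ : η ∈ neronSeveriQ Φ) (hη : ∀ v : E, v ≠ 0 → ∃ w : E, η ![v, w] ≠ 0)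
    {T : Module.End ℂ (GForm E ℂ)}
    (hT : T ∈ Algebra.adjoin ℂ ({lefschetzG η, (hasLefschetzProperty_lefschetzG hη).dual isZGrading_countingG} : Set (Module.End ℂ (GForm E ℂ)))) :
    T ∈ hodgeAlgebraEnd Φ :=
  adjoin_lefschetzG_dual_le_hodgeAlgebraEnd Φ hQ hη hT

end Adjoin

/-! ## §2 `w`, `*_L`, `∗`, `*_H`, `ᶜL` stabilise `Hdg(X)` -/

section Operators

/-- **`w(Hdg(X)) ⊆ Hdg(X)`**: the Weyl operator (`w ∈ ℂ[L, ᶜΛ]`, p34's `weylOperator_mem_adjoin_pair_dual`; André's "`(0 1 ; -1 0) ↦ ± *_H`") stabilises the Hodge algebra.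
[cite: LooijengaLunts1997, §3 p. 16] [cite: Andre1996Motifs, §1.2 (p. 11)] -/
theorem weylOperator_mem_hodgeAlgebraEnd (hQ : η ∈ neronSeveriQ Φ) (hη : ∀ v : E, v ≠ 0 → ∃ w : E, η ![v, w] ≠ 0) :
    (hasLefschetzProperty_lefschetzG hη).weylOperator isZGrading_countingG ∈ hodgeAlgebraEnd Φ :=
  adjoin_lefschetzG_dual_le_hodgeAlgebraEnd Φ hQ hη ((hasLefschetzProperty_lefschetzG hη).weylOperator_mem_adjoin_pair_dual isZGrading_countingG)

/-- **`*_L(Hdg(X)) ⊆ Hdg(X)`** (`*_L ∈ ℂ[L, ᶜΛ]`: "`ℚ[L, *_L] = ℚ[L, ᶜΛ]`"). [cite: Andre1996Motifs, Prop. 1.2 (p. 11)] [cite: LooijengaLunts1997, §3 p. 16] -/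
theorem lefschetzInvolution_mem_hodgeAlgebraEnd (hQ : η ∈ neronSeveriQ Φ) (hη : ∀ v : E, v ≠ 0 → ∃ w : E, η ![v, w] ≠ 0) :
    (hasLefschetzProperty_lefschetzG hη).lefschetzInvolution isZGrading_countingG ∈ hodgeAlgebraEnd Φ :=
  adjoin_lefschetzG_dual_le_hodgeAlgebraEnd Φ hQ hη ((hasLefschetzProperty_lefschetzG hη).lefschetzInvolution_mem_adjoin_pair_dual isZGrading_countingG)

/-- **`∗(Hdg(X)) ⊆ Hdg(X)`** for Kleiman–Milne's `∗` (every normalisation `d`; "this algebra contains `ᶜΛ` and `∗`"). [cite: Milne1999LefschetzClasses, §5 p. 665 (proof of Thm. 5.9)]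
[cite: LooijengaLunts1997, §3 p. 16] -/
theorem hodgeInvolution_mem_hodgeAlgebraEnd (hQ : η ∈ neronSeveriQ Φ) (hη : ∀ v : E, v ≠ 0 → ∃ w : E, η ![v, w] ≠ 0) (d : ℕ) :
    (hasLefschetzProperty_lefschetzG hη).hodgeInvolution isZGrading_countingG d ∈ hodgeAlgebraEnd Φ :=
  adjoin_lefschetzG_dual_le_hodgeAlgebraEnd Φ hQ hη ((hasLefschetzProperty_lefschetzG hη).hodgeInvolution_mem_adjoin_pair_dual isZGrading_countingG d)

/-- **`*_H(Hdg(X)) ⊆ Hdg(X)`** for André's rescaled Hodge involution (every normalisation `d`; "`ℚ[L, *_H] = ℚ[L, ᶜΛ]`"). [cite: Andre1996Motifs, Prop. 1.2 (p. 11)]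
[cite: LooijengaLunts1997, §3 p. 16] -/
theorem andreHodgeInvolution_mem_hodgeAlgebraEnd (hQ : η ∈ neronSeveriQ Φ) (hη : ∀ v : E, v ≠ 0 → ∃ w : E, η ![v, w] ≠ 0) (d : ℕ) :
    (hasLefschetzProperty_lefschetzG hη).andreHodgeInvolution isZGrading_countingG d ∈ hodgeAlgebraEnd Φ :=
  adjoin_lefschetzG_dual_le_hodgeAlgebraEnd Φ hQ hη ((hasLefschetzProperty_lefschetzG hη).andreHodgeInvolution_mem_adjoin_pair_dual isZGrading_countingG d)

/-- **`ᶜL(Hdg(X)) ⊆ Hdg(X)`** for André's `ᶜL = *_L L *_L` ("`ℚ[L, *_L L *_L] = ℚ[L, ᶜΛ]`"). [cite: Andre1996Motifs, Prop. 1.2 (p. 11)] [cite: LooijengaLunts1997, §3 p. 16] -/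
theorem conj_lefschetzInvolution_mem_hodgeAlgebraEnd (hQ : η ∈ neronSeveriQ Φ) (hη : ∀ v : E, v ≠ 0 → ∃ w : E, η ![v, w] ≠ 0) :
    (hasLefschetzProperty_lefschetzG hη).lefschetzInvolution isZGrading_countingG * lefschetzG η *
      (hasLefschetzProperty_lefschetzG hη).lefschetzInvolution isZGrading_countingG ∈ hodgeAlgebraEnd Φ :=
  adjoin_lefschetzG_dual_le_hodgeAlgebraEnd Φ hQ hη ((hasLefschetzProperty_lefschetzG hη).conj_lefschetzInvolution_mem_adjoin_pair_dual isZGrading_countingG)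

/-- `*_L y ∈ Hdg(X)` for `y ∈ Hdg(X)`. [cite: LooijengaLunts1997, §3 p. 16] [cite: Andre1996Motifs, Prop. 1.2 (p. 11)] -/
theorem lefschetzInvolution_apply_mem_hodgeAlgebraG (hQ : η ∈ neronSeveriQ Φ) (hη : ∀ v : E, v ≠ 0 → ∃ w : E, η ![v, w] ≠ 0) {y : GForm E ℂ}
    (hy : y ∈ hodgeAlgebraG Φ) : (hasLefschetzProperty_lefschetzG hη).lefschetzInvolution isZGrading_countingG y ∈ hodgeAlgebraG Φ :=
  lefschetzInvolution_mem_hodgeAlgebraEnd Φ hQ hη y hy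

/-- `∗ y ∈ Hdg(X)` for `y ∈ Hdg(X)`. [cite: LooijengaLunts1997, §3 p. 16] [cite: Milne1999LefschetzClasses, §5 p. 665] -/
theorem hodgeInvolution_apply_mem_hodgeAlgebraG (hQ : η ∈ neronSeveriQ Φ) (hη : ∀ v : E, v ≠ 0 → ∃ w : E, η ![v, w] ≠ 0) (d : ℕ) {y : GForm E ℂ}
    (hy : y ∈ hodgeAlgebraG Φ) : (hasLefschetzProperty_lefschetzG hη).hodgeInvolution isZGrading_countingG d y ∈ hodgeAlgebraG Φ :=
  hodgeInvolution_mem_hodgeAlgebraEnd Φ hQ hη d y hy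

/-- `w y ∈ Hdg(X)` for `y ∈ Hdg(X)`. [cite: LooijengaLunts1997, §3 p. 16] -/
theorem weylOperator_apply_mem_hodgeAlgebraG (hQ : η ∈ neronSeveriQ Φ) (hη : ∀ v : E, v ≠ 0 → ∃ w : E, η ![v, w] ≠ 0) {y : GForm E ℂ}
    (hy : y ∈ hodgeAlgebraG Φ) : (hasLefschetzProperty_lefschetzG hη).weylOperator isZGrading_countingG y ∈ hodgeAlgebraG Φ :=
  weylOperator_mem_hodgeAlgebraEnd Φ hQ hη y hy

end Operators

/-! ## §3 The `ℚ`-space of Hodge classes is preserved -/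

section HodgeClasses

/-- **`w(⊕ₘ⊕ₚ Hᵐ(X, ℚ) ∩ H^{p,p}) ⊆ ⊕ₘ⊕ₚ Hᵐ(X, ℚ) ∩ H^{p,p}`**: the Weyl operator is rational (row g47-#3) and stabilises `Hdg(X)` (§2), and
`hodgeClassesG = rationalFormsG ∩ hodgeAlgebraG`. [cite: Milne1999LefschetzClasses, §5 p. 665 and Thm. 5.9] [cite: LooijengaLunts1997, §1 (1.7), §3 p. 16] -/
theorem weylOperator_apply_mem_hodgeClassesG (hQ : η ∈ neronSeveriQ Φ) (hη : ∀ v : E, v ≠ 0 → ∃ w : E, η ![v, w] ≠ 0) {y : GForm E ℂ}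
    (hy : y ∈ hodgeClassesG Φ) : (hasLefschetzProperty_lefschetzG hη).weylOperator isZGrading_countingG y ∈ hodgeClassesG Φ := by
  rw [mem_hodgeClassesG_iff_mem_rationalFormsG_and_mem_hodgeAlgebraG] at hy ⊢
  exact ⟨weylOperator_apply_mem_rationalFormsG Φ hQ hη hy.1, weylOperator_mem_hodgeAlgebraEnd Φ hQ hη y hy.2⟩

/-- **`*_L` PRESERVES THE `ℚ`-SPACE OF HODGE CLASSES** (`η ∈ NS(X)` non-degenerate): rational (row g50-#6) and `Hdg(X)`-stabilising (§2).
[cite: Andre1996Motifs, Prop. 1.2 (p. 11)] [cite: Milne1999LefschetzClasses, §5 p. 665 and Thm. 5.9] [cite: LooijengaLunts1997, §3 p. 16] -/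
theorem IsNSForm.lefschetzInvolution_apply_mem_hodgeClassesG (hNS : IsNSForm Φ η) (hη : ∀ v : E, v ≠ 0 → ∃ w : E, η ![v, w] ≠ 0) {y : GForm E ℂ}
    (hy : y ∈ hodgeClassesG Φ) : (hasLefschetzProperty_lefschetzG hη).lefschetzInvolution isZGrading_countingG y ∈ hodgeClassesG Φ := by
  rw [mem_hodgeClassesG_iff_mem_rationalFormsG_and_mem_hodgeAlgebraG] at hy ⊢
  exact ⟨hNS.lefschetzInvolution_apply_mem_rationalFormsG Φ hη hy.1,
    lefschetzInvolution_mem_hodgeAlgebraEnd Φ (mem_neronSeveriQ_of_isNSForm Φ hNS) hη y hy.2⟩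

/-- **KLEIMAN–MILNE'S `∗` PRESERVES THE `ℚ`-SPACE OF HODGE CLASSES** (normalisation `d = g`; `η ∈ NS(X)` non-degenerate) — Milne's Thm. 5.9 says more on an abelian
variety (`∗` is a Lefschetz correspondence); here: rational (row g50-#6) and `Hdg(X)`-stabilising (§2). [cite: Milne1999LefschetzClasses, §5 p. 665 and Thm. 5.9]
[cite: Kleiman1968AlgebraicCycles, §1.4, 1.4.4] [cite: LooijengaLunts1997, §3 p. 16] -/
theorem IsNSForm.hodgeInvolution_apply_mem_hodgeClassesG (hNS : IsNSForm Φ η) (hη : ∀ v : E, v ≠ 0 → ∃ w : E, η ![v, w] ≠ 0) {y : GForm E ℂ}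
    (hy : y ∈ hodgeClassesG Φ) : (hasLefschetzProperty_lefschetzG hη).hodgeInvolution isZGrading_countingG (finrank ℂ E) y ∈ hodgeClassesG Φ := by
  rw [mem_hodgeClassesG_iff_mem_rationalFormsG_and_mem_hodgeAlgebraG] at hy ⊢
  exact ⟨hNS.hodgeInvolution_apply_mem_rationalFormsG Φ hη hy.1,
    hodgeInvolution_mem_hodgeAlgebraEnd Φ (mem_neronSeveriQ_of_isNSForm Φ hNS) hη _ y hy.2⟩

/-- **André's `*_H` preserves the `ℚ`-space of Hodge classes** (normalisation `g = dim_ℂ X`; `η ∈ NS_ℚ(X)` non-degenerate; rationality is row g49-#3).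
[cite: Andre1996Motifs, §1.1 (p. 10), Prop. 1.2 (p. 11)] [cite: LooijengaLunts1997, §3 p. 16] -/
theorem andreHodgeInvolution_apply_mem_hodgeClassesG (hQ : η ∈ neronSeveriQ Φ) (hη : ∀ v : E, v ≠ 0 → ∃ w : E, η ![v, w] ≠ 0) {g : ℕ}
    (hg : finrank ℂ E = g) {y : GForm E ℂ} (hy : y ∈ hodgeClassesG Φ) :
    (hasLefschetzProperty_lefschetzG hη).andreHodgeInvolution isZGrading_countingG g y ∈ hodgeClassesG Φ := by
  rw [mem_hodgeClassesG_iff_mem_rationalFormsG_and_mem_hodgeAlgebraG] at hy ⊢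
  exact ⟨andreHodgeInvolution_apply_mem_rationalFormsG Φ hQ hη hg hy.1, andreHodgeInvolution_mem_hodgeAlgebraEnd Φ hQ hη g y hy.2⟩

/-- **André's `ᶜL = *_L L *_L` preserves the `ℚ`-space of Hodge classes** (`η ∈ NS(X)` non-degenerate; rationality is row g50-#8).
[cite: Andre1996Motifs, §1.1 (p. 11), Prop. 1.2] [cite: LooijengaLunts1997, §3 p. 16] -/
theorem IsNSForm.conj_lefschetzInvolution_apply_mem_hodgeClassesG (hNS : IsNSForm Φ η) (hη : ∀ v : E, v ≠ 0 → ∃ w : E, η ![v, w] ≠ 0) {y : GForm E ℂ}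
    (hy : y ∈ hodgeClassesG Φ) :
    ((hasLefschetzProperty_lefschetzG hη).lefschetzInvolution isZGrading_countingG * lefschetzG η *
      (hasLefschetzProperty_lefschetzG hη).lefschetzInvolution isZGrading_countingG) y ∈ hodgeClassesG Φ := by
  rw [mem_hodgeClassesG_iff_mem_rationalFormsG_and_mem_hodgeAlgebraG] at hy ⊢
  exact ⟨hNS.conj_lefschetzInvolution_mem_rationalEnd Φ hη y hy.1,
    conj_lefschetzInvolution_mem_hodgeAlgebraEnd Φ (mem_neronSeveriQ_of_isNSForm Φ hNS) hη y hy.2⟩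

end HodgeClasses

/-! ## §4 Glue: rational AND `Hdg(X)`-stabilising -/

section Glue

/-- **`*_L ∈ 𝔤𝔩(H•(X; ℚ)) ∩ Stab(Hdg(X))`** (the form consumed with `𝔤_NS(X) ⊆ rationalEnd Φ ⊓ hodgeAlgebraEnd Φ` of A1-60). [cite: LooijengaLunts1997, §1 (1.7); §3 p. 16]
[cite: Andre1996Motifs, Prop. 1.2 (p. 11)] -/
theorem IsNSForm.lefschetzInvolution_mem_rationalEnd_and_mem_hodgeAlgebraEnd (hNS : IsNSForm Φ η) (hη : ∀ v : E, v ≠ 0 → ∃ w : E, η ![v, w] ≠ 0) :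
    (hasLefschetzProperty_lefschetzG hη).lefschetzInvolution isZGrading_countingG ∈ rationalEnd Φ ∧
      (hasLefschetzProperty_lefschetzG hη).lefschetzInvolution isZGrading_countingG ∈ hodgeAlgebraEnd Φ :=
  ⟨hNS.lefschetzInvolution_mem_rationalEnd Φ hη, lefschetzInvolution_mem_hodgeAlgebraEnd Φ (mem_neronSeveriQ_of_isNSForm Φ hNS) hη⟩

/-- **`∗ ∈ 𝔤𝔩(H•(X; ℚ)) ∩ Stab(Hdg(X))`** (normalisation `d = g`). [cite: Milne1999LefschetzClasses, §5 p. 665 and Thm. 5.9] [cite: LooijengaLunts1997, §1 (1.7); §3 p. 16] -/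
theorem IsNSForm.hodgeInvolution_mem_rationalEnd_and_mem_hodgeAlgebraEnd (hNS : IsNSForm Φ η) (hη : ∀ v : E, v ≠ 0 → ∃ w : E, η ![v, w] ≠ 0) :
    (hasLefschetzProperty_lefschetzG hη).hodgeInvolution isZGrading_countingG (finrank ℂ E) ∈ rationalEnd Φ ∧
      (hasLefschetzProperty_lefschetzG hη).hodgeInvolution isZGrading_countingG (finrank ℂ E) ∈ hodgeAlgebraEnd Φ :=
  ⟨hNS.hodgeInvolution_mem_rationalEnd Φ hη, hodgeInvolution_mem_hodgeAlgebraEnd Φ (mem_neronSeveriQ_of_isNSForm Φ hNS) hη _⟩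

end Glue

end ComplexTorus

end Literature.Geometry.Kaehler

end
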